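/-
Copyright (c) 2026 the pub-hodgecm-mathlib formalisation cell (harness21).  Prover seat hodgecm-mathlib-K2E5-p17 (g3) (free E5 hand on the E3 road),
Track B «K2-LIT» ∕ h413 (`stmt-HodgeConjecture-24833`), line `K2_E3_EllipticInputs`, unit U12-d, §L road «U-iso-T», brick (G⁺-b) LINE SIDE, part 6:
the QUANTITATIVE truncation identity (T2) — explicit in the constancy exponent of `G` (asked by name, K2E5-p10 (g4) 05:05:05Z).  2026-09-04.
-/
import Summits.HodgeConjecture.HodgeConjecture.Theorems.K2E3LocalFieldQuadraticCharLineInversionRamified   -- ★ part 5b (p857477); brings parts 1–5a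
import HarnessLib

/-!
# K2_E3 road (h413), §L — (G⁺-b) line side, part 6: the quantitative truncation identity

Cell `pub/hodgecm-mathlib` (D-0151), Track B, seat K2E5-p17 (g3) ((G⁺-b) cut with K2E5-p10 (g4)).  `--supports stmt-HodgeConjecture-24833 --as helper`;
THEOREMS ONLY.  COUNT-NEUTRAL.

The K-side swaps `lim_n` with `∫_K dκ` in `∫_K χ̃(a⁻¹ det k) Z₀(G_k) dκ`, where all `G_k` are constant on ONE ball `𝔭^N`; so it needs (T2) with the truncation exponent explicit
in the constancy exponent rather than `∀ᶠ`.  For `G ∈ SchwartzBruhat F` with `G = G(0)` on `𝔭^N` (`N : ℤ`) and `Z₀(G) = ∫ X(s) ‖s‖⁻¹ (G s − 1_𝒪(s) G 0) dμ`: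
* `setIntegral_compl_primePowBall_even_eq_of_forall_mem` (sign weight `X` of parts 1–3): `N ≤ 2n ⇒ ∫_{(𝔭^{2n})ᶜ} X ‖·‖⁻¹ G = Z₀(G)`;
* `setIntegral_compl_primePowBall_eq_of_ramified_of_forall_mem` (ramified quadratic `χ`): `N ≤ n ⇒ ∫_{(𝔭^{n})ᶜ} χ̃ ‖·‖⁻¹ G = Z₀(G)` (every `n : ℕ`);
* **`setIntegral_compl_primePowBall_even_eq_of_quadratic`** (every non-trivial quadratic `χ`): `N ≤ 2n ⇒ ∫_{(𝔭^{2n})ᶜ} χ̃ ‖·‖⁻¹ G = Z₀(G)`.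
[Tate1950, §2.5] [BushnellHenniart2006, §23.5].
HONEST LABEL: HC_CM is proved only modulo the 7 printed citations (2 remaining named inputs: hLiu418 = stmt-HodgeConjecture-24832, h413 = stmt-HodgeConjecture-24833)
until rung 0 closes; count-neutral.
-/

set_option autoImplicit false
set_option linter.dupNamespace false   -- `Summit.HodgeConjecture.HodgeConjecture.…` (D-0017 nested layout; lakefile exemption for Summits)

noncomputable section

open MeasureTheory Measure Filter Topology Set
open scoped NNReal ENNReal Pointwise
open Literature.NumberTheory.Automorphic Literature.NumberTheory.Automorphic.LocalFieldHaar Literature.NumberTheory.Automorphic.TateDirect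
open Literature.NumberTheory.GaloisRepresentations Literature.NumberTheory.GaloisRepresentations.IsNonarchimedeanLocalField
open Summit.HodgeConjecture.HodgeConjecture.Cruxes.H413.K2E3LocalFieldSignCharLineLemmas
open Summit.HodgeConjecture.HodgeConjecture.Cruxes.H413.K2E3LocalFieldSignCharZetaBalls
open Summit.HodgeConjecture.HodgeConjecture.Cruxes.H413.K2E3LocalFieldQuadraticCharSignWeight
open Summit.HodgeConjecture.HodgeConjecture.Cruxes.H413.K2E3LocalFieldQuadraticCharRamifiedLemmas

namespace Summit.HodgeConjecture.HodgeConjecture.Cruxes.H413.K2E3LocalFieldQuadraticCharTruncation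

variable {F : Type*} [Field F] [ValuativeRel F] [TopologicalSpace F] [IsNonarchimedeanLocalField F] [MeasurableSpace F] [BorelSpace F]
  (μ : Measure F) [μ.IsAddHaarMeasure]

/-! ## §1  The common core: a bounded measurable weight whose `G(0)`-term over `𝒪 ∖ 𝔭^{k}` vanishes -/

open scoped Classical in
/-- Core of (T2): for a bounded measurable weight `X` with `∫_{𝒪 ∖ 𝔭^{k}} X ‖·‖⁻¹ = 0`, and `G ∈ SchwartzBruhat F` constant on `𝔭^N` with `N ≤ k`,
`∫_{(𝔭^{k})ᶜ} X ‖·‖⁻¹ G = Z₀(G)`. [cite: Tate1950, §2.5] -/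
theorem setIntegral_compl_primePowBall_eq_of_forall_mem {X : F → ℂ} (hXm : Measurable X) (hXb : ∀ x, ‖X x‖ ≤ 1)
    {k : ℕ} (hXk : ∫ s in primePowBall F 0 \ primePowBall F (0 + k), X s * ((((normAbs F s)⁻¹ : ℝ≥0) : ℝ) : ℂ) ∂μ = 0)
    {G : F → ℂ} (hG : G ∈ SchwartzBruhat F) {N : ℤ} (hGN : ∀ s ∈ primePowBall F N, G s = G 0) (hn : N ≤ (k : ℤ)) :
    ∫ s in (primePowBall F (k : ℤ))ᶜ, X s * ((((normAbs F s)⁻¹ : ℝ≥0) : ℝ) : ℂ) * G s ∂μ =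
      ∫ s, X s * ((((normAbs F s)⁻¹ : ℝ≥0) : ℝ) : ℂ) * (G s - (primePowBall F 0).indicator (fun _ => G 0) s) ∂μ := by
  haveI : T2Space F := (isLocalField F).toT2Space
  haveI : LocallyCompactSpace F := (isLocalField F).toLocallyCompactSpace
  have hGi : Integrable G μ := ((mem_schwartzBruhat_iff).1 hG).1.continuous.integrable_of_hasCompactSupport ((mem_schwartzBruhat_iff).1 hG).2
  have hvan : ∀ s, s ∉ (primePowBall F (k : ℤ))ᶜ →
      X s * ((((normAbs F s)⁻¹ : ℝ≥0) : ℝ) : ℂ) * (G s - (primePowBall F 0).indicator (fun _ => G 0) s) = 0 := by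
    intro s hs'
    have hs : s ∈ primePowBall F (k : ℤ) := by simpa using hs'
    have hs0 : s ∈ primePowBall F 0 := primePowBall_antitone (by omega) hs
    have hsN : s ∈ primePowBall F N := primePowBall_antitone hn hs
    rw [Set.indicator_of_mem hs0, hGN s hsN, sub_self, mul_zero]
  rw [← setIntegral_eq_integral_of_forall_compl_eq_zero hvan]
  have hmeas : MeasurableSet (primePowBall F (k : ℤ))ᶜ := (measurableSet_primePowBall _).compl
  have hI1 : IntegrableOn (fun s => X s * ((((normAbs F s)⁻¹ : ℝ≥0) : ℝ) : ℂ) * G s) (primePowBall F (k : ℤ))ᶜ μ := by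
    refine (hGi.integrableOn).bdd_mul (c := (residueFieldCard F : ℝ) ^ (k : ℤ)) ((hXm.mul measurable_normInv).aestronglyMeasurable) ?_
    rw [ae_restrict_iff' hmeas]
    refine Filter.Eventually.of_forall fun s hs => ?_
    rw [norm_mul]
    calc ‖X s‖ * ‖((((normAbs F s)⁻¹ : ℝ≥0) : ℝ) : ℂ)‖ ≤ 1 * (residueFieldCard F : ℝ) ^ (k : ℤ) :=
          mul_le_mul (hXb s) (norm_normInv_le hs) (norm_nonneg _) zero_le_one
      _ = (residueFieldCard F : ℝ) ^ (k : ℤ) := one_mul _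
  have hind : (fun s => X s * ((((normAbs F s)⁻¹ : ℝ≥0) : ℝ) : ℂ) * (primePowBall F 0).indicator (fun _ => G 0) s) =
      (primePowBall F 0).indicator (fun s => G 0 * (X s * ((((normAbs F s)⁻¹ : ℝ≥0) : ℝ) : ℂ))) := by
    funext s
    by_cases hs : s ∈ primePowBall F 0
    · rw [Set.indicator_of_mem hs, Set.indicator_of_mem hs]; ring
    · simp [hs]
  have hset : (primePowBall F (k : ℤ))ᶜ ∩ primePowBall F 0 = primePowBall F 0 \ primePowBall F (0 + k) := by
    rw [Set.sdiff_eq_compl_inter, zero_add]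
  have hI2 : IntegrableOn (fun s => X s * ((((normAbs F s)⁻¹ : ℝ≥0) : ℝ) : ℂ) * (primePowBall F 0).indicator (fun _ => G 0) s)
      (primePowBall F (k : ℤ))ᶜ μ := by
    rw [hind, IntegrableOn, integrable_indicator_iff (measurableSet_primePowBall 0), IntegrableOn,
      Measure.restrict_restrict (measurableSet_primePowBall 0), Set.inter_comm, hset]
    exact ((integrableOn_sign_mul_normInv μ hXm hXb 0 _).const_mul (G 0))
  have hzero : ∫ s in (primePowBall F (k : ℤ))ᶜ, X s * ((((normAbs F s)⁻¹ : ℝ≥0) : ℝ) : ℂ) *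
      (primePowBall F 0).indicator (fun _ => G 0) s ∂μ = 0 := by
    rw [hind, setIntegral_indicator (measurableSet_primePowBall 0), hset, integral_const_mul, hXk, mul_zero]
  simp_rw [mul_sub]
  rw [integral_sub hI1 hI2, hzero, sub_zero]

/-! ## §2  The sign weight (unramified case): even truncations -/

section Sign
variable {X : F → ℂ} (hXm : Measurable X) (hXb : ∀ x, ‖X x‖ ≤ 1)
  (hX : ∀ (j : ℤ) (x : F), x ∈ primePowBall F j \ primePowBall F (j + 1) → X x = (-1) ^ j)

open scoped Classical in
include hXm hXb hX in
/-- **Quantitative (T2), sign weight**: `G` constant on `𝔭^N`, `N ≤ 2n` ⇒ `∫_{(𝔭^{2n})ᶜ} X ‖·‖⁻¹ G = Z₀(G)`. [cite: Tate1950, §2.5] -/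
theorem setIntegral_compl_primePowBall_even_eq_of_forall_mem {G : F → ℂ} (hG : G ∈ SchwartzBruhat F) {N : ℤ}
    (hGN : ∀ s ∈ primePowBall F N, G s = G 0) {n : ℕ} (hn : N ≤ 2 * n) :
    ∫ s in (primePowBall F (2 * n : ℤ))ᶜ, X s * ((((normAbs F s)⁻¹ : ℝ≥0) : ℝ) : ℂ) * G s ∂μ =
      ∫ s, X s * ((((normAbs F s)⁻¹ : ℝ≥0) : ℝ) : ℂ) * (G s - (primePowBall F 0).indicator (fun _ => G 0) s) ∂μ := by
  have hk : ∫ s in primePowBall F 0 \ primePowBall F (0 + (2 * n : ℕ)), X s * ((((normAbs F s)⁻¹ : ℝ≥0) : ℝ) : ℂ) ∂μ = 0 := by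
    rw [setIntegral_sdiff_sign_mul_normInv μ hXm hXb hX 0 (2 * n)]
    have h1 : ((-1 : ℂ)) ^ ((0 : ℤ) + ((2 * n : ℕ) : ℤ)) = 1 := by
      rw [zero_add, Nat.cast_mul, Nat.cast_ofNat, zpow_mul]; norm_num
    rw [h1, zpow_zero, sub_self, zero_div, mul_zero]
  have h := setIntegral_compl_primePowBall_eq_of_forall_mem μ hXm hXb hk hG hGN (by push_cast; omega)
  simpa only [Nat.cast_mul, Nat.cast_ofNat] using h

end Sign

/-! ## §3  Ramified quadratic `χ`: every truncation -/

section Ramified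
variable (χ : QuasiChar F) (hχr : ¬ χ.IsUnramified) (hχ2 : ∀ u, χ u * χ u = 1)

open scoped Classical in
include hχr hχ2 in
/-- **Quantitative (T2), ramified quadratic `χ`**: `G` constant on `𝔭^N`, `N ≤ n` ⇒ `∫_{(𝔭^{n})ᶜ} χ̃ ‖·‖⁻¹ G = Z₀(G)` (every `n : ℕ`). [cite: Tate1950, §2.5] -/
theorem setIntegral_compl_primePowBall_eq_of_ramified_of_forall_mem {G : F → ℂ} (hG : G ∈ SchwartzBruhat F) {N : ℤ}
    (hGN : ∀ s ∈ primePowBall F N, G s = G 0) {n : ℕ} (hn : N ≤ n) :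
    ∫ s in (primePowBall F (n : ℤ))ᶜ,
        Function.extend ((↑) : Fˣ → F) (fun u => ((χ u : ℂˣ) : ℂ)) 0 s * ((((normAbs F s)⁻¹ : ℝ≥0) : ℝ) : ℂ) * G s ∂μ =
      ∫ s, Function.extend ((↑) : Fˣ → F) (fun u => ((χ u : ℂˣ) : ℂ)) 0 s * ((((normAbs F s)⁻¹ : ℝ≥0) : ℝ) : ℂ) *
        (G s - (primePowBall F 0).indicator (fun _ => G 0) s) ∂μ :=
  setIntegral_compl_primePowBall_eq_of_forall_mem μ (measurable_extend χ) (norm_extend_le_one χ hχ2)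
    (setIntegral_sdiff_extend_mul_normInv_eq_zero μ χ hχr hχ2 0 n) hG hGN hn

end Ramified

/-! ## §4  Every non-trivial quadratic `χ`: even truncations -/

section Quadratic
variable (χ : QuasiChar F) (hχ2 : ∀ u, χ u * χ u = 1) (hχ1 : ∃ u, χ u ≠ 1)

open scoped Classical in
include hχ2 hχ1 in
/-- **QUANTITATIVE (T2), every non-trivial quadratic `χ`** (asked by name, K-side): for `G ∈ SchwartzBruhat F` with `G = G 0` on `𝔭^N` and `N ≤ 2n`,
`∫_{(𝔭^{2n})ᶜ} χ̃(s) ‖s‖⁻¹ G(s) dμ = Z₀(G) = ∫ χ̃(s) ‖s‖⁻¹ (G s − 1_𝒪(s) G 0) dμ` — one `n` for a whole family `G_k` constant on the same ball.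
[cite: Tate1950, §2.5] [cite: BushnellHenniart2006, §23.5] -/
theorem setIntegral_compl_primePowBall_even_eq_of_quadratic {G : F → ℂ} (hG : G ∈ SchwartzBruhat F) {N : ℤ}
    (hGN : ∀ s ∈ primePowBall F N, G s = G 0) {n : ℕ} (hn : N ≤ 2 * n) :
    ∫ s in (primePowBall F (2 * n : ℤ))ᶜ,
        Function.extend ((↑) : Fˣ → F) (fun u => ((χ u : ℂˣ) : ℂ)) 0 s * ((((normAbs F s)⁻¹ : ℝ≥0) : ℝ) : ℂ) * G s ∂μ =
      ∫ s, Function.extend ((↑) : Fˣ → F) (fun u => ((χ u : ℂˣ) : ℂ)) 0 s * ((((normAbs F s)⁻¹ : ℝ≥0) : ℝ) : ℂ) *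
        (G s - (primePowBall F 0).indicator (fun _ => G 0) s) ∂μ := by
  by_cases hχ : χ.IsUnramified
  · obtain ⟨ϖ, _, hϖ⟩ := exists_normAbs_eq_inv (F := F)
    exact setIntegral_compl_primePowBall_even_eq_of_forall_mem μ (measurable_extend χ) (norm_extend_le_one χ hχ2)
      (extend_eq_neg_one_zpow_of_mem_shell χ hχ hχ2 hχ1 hϖ) hG hGN hn
  · have h := setIntegral_compl_primePowBall_eq_of_ramified_of_forall_mem μ χ hχ hχ2 hG hGN (n := 2 * n) (by push_cast; omega)
    simpa only [Nat.cast_mul, Nat.cast_ofNat] using h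

end Quadratic

end Summit.HodgeConjecture.HodgeConjecture.Cruxes.H413.K2E3LocalFieldQuadraticCharTruncation
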